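import Literature.AlgebraicGeometry.Frobenioids.BirationalizationCor410
import Literature.AlgebraicGeometry.Frobenioids.PerfectionFunctoriality
import Literature.AnabelianGeometry.EtaleTheta.BiKummerThm44SubModelConnected

/-!
# [EtTh] Theorem 4.4 (ii), clause (a) AT THE CATEGORY LEVEL — `Ψ^birat : C₁^birat ⥲ C₂^birat` — and the
# perfection compatibility of `Ψ` (sub-DAG row T44-L11) — proof-only companion

S. Mochizuki, *The étale theta function and its Frobenioid-theoretic manifestations*, Publ. RIMS **45**
(2009) [MochizukiEtTh2009], §4, Theorem 4.4 (ii), p.94 (printed p.320 l.12): "`Ψ` induces a 1-compatible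
equivalence of categories `Ψ^birat : C₁^birat ⥲ C₂^birat`."; proof, p.95 (printed p.321) ll.7–10: "The
existence of `Ψ^birat` follows from [FrdI], Corollary 4.10. … `Ψ` is compatible with the operation of passing
to the perfection [cf. Theorem 3.7, (i), (ii); [FrdI], Theorem 3.4, (iii)]".

Cell abc-iut, layer L2, cone node `EtTh:Thm4.4(ii)`, sub-DAG `plan/L2/SUBDAG-EtTh-Thm44.md`; seat
abc-iut-w6-d079 (W6 tranche 2).  PROOF-ONLY (no definition, no named fact, nothing restated).

So far the sub-DAG renders clause (a) of Thm 4.4 (ii) only THROUGH ITS EFFECT ON UNITS (row T44-L10: the datum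
`ψ_A : O^×(A^birat) ⥲ O^×(Ψ(A)^birat)`, `Thm44Hyp.psiModel`, `BiKummerThm44SubModelBirat.lean`), and row T44-L11
(perfection compatibility) is not typed.  Here both are read AT THE CATEGORY LEVEL, by instantiating abc-iut-L1's
[FrdI] Cor 4.10 / Thm 3.4 (iii) machinery (`BirationalizationCategoryTheoreticity.lean`,
`BirationalizationCor410.lean`, `PerfectionFunctoriality.lean`) at the pair of tempered Frobenioids `C₁, C₂` and
the equivalence `Ψ` of a `Thm44Hyp`:

* `Thm44Hyp.oneUniqueSquare_birat` — for ANY pair of settings and `h : Thm44Hyp S₁ S₂`, from "`C_i` is a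
  Frobenioid" and T44-L03 (`PreservesFrobeniusStructure`): the functor `Ψ^birat := Birat.mapOfEquiv` between THE
  birationalizations `C_i^birat` ([FrdI] Prop 4.4, the localizations at the co-angular pre-steps) is an
  EQUIVALENCE, makes the square with `C_i → C_i^birat` `1`-commute, and is `1`-unique
  (`PreFrobenioidData.OneUniqueSquare`); the inputs "`Ψ`, `Ψ⁻¹` preserve co-angular pre-steps" are the sub-DAG's
  `Thm44Hyp.isCoAngularPreStep_map` / `…_inverse_map` (T44-L03 + Thm 3.7 (i) isotropic, PROVED);
* `Thm44Hyp.exists_biratEquivalence` — print's wording: there is an equivalence `Ψ^birat : C₁^birat ⥲ C₂^birat`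
  with `(C₁ → C₁^birat) ⋙ Ψ^birat ≅ Ψ ⋙ (C₂ → C₂^birat)`;
* `Thm44Hyp.cor410_birat` — the typed [FrdI] Cor 4.10 (`PreFrobenioidData.Cor410`, incl. its rigidity clause)
  at `(C₁, C₂, Ψ)` and THE birationalizations;
* `Thm44Hyp.isFrobeniusCompatible` — T44-L03 ⇒ `Ψ` carries arrows of Frobenius type to arrows of Frobenius type
  of the same Frobenius degree; hence (T44-L11) `Thm44Hyp.perfectionMap_isEquivalence`,
  `Thm44Hyp.oneCommutes_perfection`, `Thm44Hyp.exists_pfEquivalence` — `Ψ^pf := Perfection.map` is an equivalence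
  `C₁^pf ⥲ C₂^pf` with `(C₁ → C₁^pf) ⋙ Ψ^pf ≅ Ψ ⋙ (C₂ → C₂^pf)` ("compatible with passing to the perfection");
* the same at the tree vocabularies `treeMonoidVocab` / `treeCatVocab` ⇐ {Rmk 3.7.2 (`Remark372 D₀ / D₀'`),
  `hBmon₁ / hBmon₂`} ONLY (`…_treeVocab`), and at abc-iut-L2-t4's genuine connected base
  `mkOfConnectedTemperoid` over `D_i = B^temp(Π^tp_{X_i})⁰` (`…_mkOfConnectedTemperoid`).

The `1`-uniqueness conjunct of the PERFECTION square is not asserted here (abc-iut-L1 proves it for `C₁` of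
perfect type, `Perfection.oneUniqueSquare_map_of_isOfPerfectType`; "`C_i` of perfect type" is not yet a tree
theorem for tempered Frobenioids); print's sentence asks only for compatibility.  HONEST FRAMING: refereed pre-IUT
material ([EtTh] §4 over [FrdI] §§3–4); nothing here asserts that such data exist for an actual curve or bears on
the disputed [IUTchIII] Cor. 3.12; typed ≠ proved — here PROVED (kernel compositions of landed theorems).
-/

noncomputable section

namespace Literature.AnabelianGeometry.EtaleTheta

open CategoryTheory Opposite Literature.AlgebraicGeometry.Frobenioids Literature.AnabelianGeometry.SemiGraphs

namespace BiKummerSetting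

universe u₀ v₀ u v w

/-! ### Any pair of settings: inputs "`C_i` Frobenioid" and T44-L03 -/

section AnySetting

variable {K : Type u₀} [Field K] {K' : Type u₀} [Field K'] {D₀ : Type u₀} [Category.{v₀} D₀]
  {V : FrdIMonoidStub.{w}}
  {X₁ : SemiGraphs.TemperedArithmeticGroup.{u₀} K} {X₂ : SemiGraphs.TemperedArithmeticGroup.{u₀} K'}
  {D₀' : Type u₀} [Category.{v₀} D₀']
  {T₁ : RealifiedDivisorMonoids (D₀ := D₀) V} {T₂ : RealifiedDivisorMonoids (D₀ := D₀') V}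
  {D₁ D₂ : Type u} [Category.{v} D₁] [Category.{v} D₂] {VD₁ : FrdICatStub.{u, v, w} D₁}
  {VD₂ : FrdICatStub.{u, v, w} D₂} {S₁ : BiKummerSetting X₁ T₁ D₁ VD₁} {S₂ : BiKummerSetting X₂ T₂ D₂ VD₂}

/-- **Thm 4.4 (ii), clause (a), at the category level** ("`Ψ` induces a 1-compatible equivalence of categories
`Ψ^birat : C₁^birat ⥲ C₂^birat`", [FrdI] Cor 4.10): for THE birationalizations `C_i^birat` of the Frobenioids
`C_i` and `Ψ^birat := Birat.mapOfEquiv` (the localization lift of `Ψ ⋙ (C₂ → C₂^birat)`), `Ψ^birat` is an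
equivalence, the square with `C_i → C_i^birat` `1`-commutes, and `Ψ^birat` is `1`-unique — inputs "`C_i` is a
Frobenioid" and T44-L03 (through `isCoAngularPreStep_map` / `…_inverse_map`, Thm 3.7 (i) isotropic).
[cite: MochizukiEtTh2009, Thm 4.4 (ii) p.94] -/
theorem Thm44Hyp.oneUniqueSquare_birat (h : Thm44Hyp S₁ S₂) (hF₁ : PreFrobenioid.IsFrobenioid S₁.F)
    (hF₂ : PreFrobenioid.IsFrobenioid S₂.F) (h3 : h.PreservesFrobeniusStructure) :
    PreFrobenioidData.OneUniqueSquare h.Ψ.functor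
      (PreFrobenioid.toBirat S₁.F hF₁ (PreFrobenioid.hasBiratSquares_of_isFrobenioid hF₁))
      (PreFrobenioid.toBirat S₂.F hF₂ (PreFrobenioid.hasBiratSquares_of_isFrobenioid hF₂))
      (PreFrobenioid.Birat.mapOfEquiv hF₁ (PreFrobenioid.hasBiratSquares_of_isFrobenioid hF₁) hF₂
        (PreFrobenioid.hasBiratSquares_of_isFrobenioid hF₂) h.Ψ
        (fun _ _ _ hf => h.isCoAngularPreStep_map h3 hf)) :=
  PreFrobenioid.Birat.oneUniqueSquare_mapOfEquiv hF₁ _ hF₂ _ h.Ψ _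
    (fun _ _ _ hf => h.isCoAngularPreStep_inverse_map h3 hf)

/-- **Thm 4.4 (ii), clause (a), in print's wording**: there is an equivalence of categories
`Ψ^birat : C₁^birat ⥲ C₂^birat` compatible with `Ψ` — `(C₁ → C₁^birat) ⋙ Ψ^birat ≅ Ψ ⋙ (C₂ → C₂^birat)`.
[cite: MochizukiEtTh2009, Thm 4.4 (ii) p.94] -/
theorem Thm44Hyp.exists_biratEquivalence (h : Thm44Hyp S₁ S₂) (hF₁ : PreFrobenioid.IsFrobenioid S₁.F)
    (hF₂ : PreFrobenioid.IsFrobenioid S₂.F) (h3 : h.PreservesFrobeniusStructure) :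
    ∃ Ψbirat : PreFrobenioid.Birat S₁.F hF₁ (PreFrobenioid.hasBiratSquares_of_isFrobenioid hF₁) ≌
        PreFrobenioid.Birat S₂.F hF₂ (PreFrobenioid.hasBiratSquares_of_isFrobenioid hF₂),
      Nonempty (PreFrobenioid.toBirat S₁.F hF₁ (PreFrobenioid.hasBiratSquares_of_isFrobenioid hF₁) ⋙
          Ψbirat.functor ≅
        h.Ψ.functor ⋙ PreFrobenioid.toBirat S₂.F hF₂ (PreFrobenioid.hasBiratSquares_of_isFrobenioid hF₂)) := by
  haveI := PreFrobenioid.Birat.mapOfEquiv_isEquivalence hF₁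
    (PreFrobenioid.hasBiratSquares_of_isFrobenioid hF₁) hF₂ (PreFrobenioid.hasBiratSquares_of_isFrobenioid hF₂)
    h.Ψ (fun _ _ _ hf => h.isCoAngularPreStep_map h3 hf) (fun _ _ _ hf => h.isCoAngularPreStep_inverse_map h3 hf)
  exact ⟨(PreFrobenioid.Birat.mapOfEquiv hF₁ _ hF₂ _ h.Ψ
      (fun _ _ _ hf => h.isCoAngularPreStep_map h3 hf)).asEquivalence,
    ⟨PreFrobenioid.Birat.mapOfEquivFac hF₁ _ hF₂ _ h.Ψ (fun _ _ _ hf => h.isCoAngularPreStep_map h3 hf)⟩⟩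

/-- **[FrdI] Cor 4.10 AS TYPED at `(C₁, C₂, Ψ)`** (`PreFrobenioidData.Cor410` at THE birationalizations: for
FSMFF-type bases and quasi-isotropic `C_i`, a `1`-unique `Ψ^birat` making the square `1`-commute; for slim bases
and `C_i` of birationally Frobenius-normalized type, rigidity of the composites) — abc-iut-L1's
`PreFrobenioid.cor410_biratData` with its two inputs "`Ψ`, `Ψ⁻¹` preserve co-angular pre-steps" supplied by
T44-L03. [cite: MochizukiEtTh2009, Thm 4.4 (ii) p.95] -/
theorem Thm44Hyp.cor410_birat (h : Thm44Hyp S₁ S₂) (hF₁ : PreFrobenioid.IsFrobenioid S₁.F)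
    (hF₂ : PreFrobenioid.IsFrobenioid S₂.F) (h3 : h.PreservesFrobeniusStructure) :
    PreFrobenioidData.Cor410 (PreFrobenioidData.ofFunctor S₁.tf.divisorMonoid S₁.F)
      (PreFrobenioidData.ofFunctor S₂.tf.divisorMonoid S₂.F) h.Ψ
      (PreFrobenioid.biratData hF₁ (PreFrobenioid.hasBiratSquares_of_isFrobenioid hF₁))
      (PreFrobenioid.biratData hF₂ (PreFrobenioid.hasBiratSquares_of_isFrobenioid hF₂)) :=
  PreFrobenioid.cor410_biratData hF₁ _ hF₂ _ h.Ψ (fun _ _ _ hf => h.isCoAngularPreStep_map h3 hf)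
    (fun _ _ _ hf => h.isCoAngularPreStep_inverse_map h3 hf)

/-! ### T44-L11: "`Ψ` is compatible with the operation of passing to the perfection" -/

/-- **T44-L11, the input of [FrdI] Thm 3.4 (iii)'s perfection square**: `Ψ` carries arrows of Frobenius type to
arrows of Frobenius type of the same Frobenius degree (`PreFrobenioid.IsFrobeniusCompatible`) — two clauses of
T44-L03 ("`Ψ` preserves … morphisms of Frobenius type, Frobenius degrees"). [cite: MochizukiEtTh2009, Thm 4.4 (ii) p.95] -/
theorem Thm44Hyp.isFrobeniusCompatible (h : Thm44Hyp S₁ S₂) (h3 : h.PreservesFrobeniusStructure) :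
    PreFrobenioid.IsFrobeniusCompatible S₁.F S₂.F h.Ψ.functor :=
  ⟨fun _ _ φ hφ => h3.2.2.1 φ hφ, fun _ _ φ _ => h3.1 φ⟩

/-- **T44-L11** ("`Ψ` is compatible with the operation of passing to the perfection [cf. [FrdI], Theorem 3.4,
(iii)]"): for THE perfections `C_i^pf` ([FrdI] Def 3.1 (iii)) the functor `Ψ^pf := Perfection.map` induced by
`Ψ` is an EQUIVALENCE of categories — inputs "`C_i` is a Frobenioid" and T44-L03.
[cite: MochizukiEtTh2009, Thm 4.4 (ii) p.95] -/
theorem Thm44Hyp.perfectionMap_isEquivalence (h : Thm44Hyp S₁ S₂) (hF₁ : PreFrobenioid.IsFrobenioid S₁.F)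
    (hF₂ : PreFrobenioid.IsFrobenioid S₂.F) (h3 : h.PreservesFrobeniusStructure) :
    (PreFrobenioid.Perfection.map (hF₁ := hF₁) (hF₂ := hF₂) (h.isFrobeniusCompatible h3)).IsEquivalence :=
  PreFrobenioid.Perfection.map_isEquivalence h.Ψ _

/-- **T44-L11**, the `1`-commutative square: `(C₁ → C₁^pf) ⋙ Ψ^pf ≅ Ψ ⋙ (C₂ → C₂^pf)` (`OneCommutes`, with
abc-iut-L1's identity-component isomorphism `Perfection.toPfCompMapIso`). [cite: MochizukiEtTh2009, Thm 4.4 (ii) p.95] -/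
theorem Thm44Hyp.oneCommutes_perfection (h : Thm44Hyp S₁ S₂) (hF₁ : PreFrobenioid.IsFrobenioid S₁.F)
    (hF₂ : PreFrobenioid.IsFrobenioid S₂.F) (h3 : h.PreservesFrobeniusStructure) :
    OneCommutes (PreFrobenioid.Perfection.toPf hF₁)
      (PreFrobenioid.Perfection.map (hF₁ := hF₁) (hF₂ := hF₂) (h.isFrobeniusCompatible h3))
      h.Ψ.functor (PreFrobenioid.Perfection.toPf hF₂) :=
  PreFrobenioid.Perfection.oneCommutes_toPf_map (h.isFrobeniusCompatible h3)

/-- **T44-L11 in print's wording**: there is an equivalence `Ψ^pf : C₁^pf ⥲ C₂^pf` compatible with `Ψ` and the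
natural functors `C_i → C_i^pf` — `(C₁ → C₁^pf) ⋙ Ψ^pf ≅ Ψ ⋙ (C₂ → C₂^pf)`. [cite: MochizukiEtTh2009, Thm 4.4 (ii) p.95] -/
theorem Thm44Hyp.exists_pfEquivalence (h : Thm44Hyp S₁ S₂) (hF₁ : PreFrobenioid.IsFrobenioid S₁.F)
    (hF₂ : PreFrobenioid.IsFrobenioid S₂.F) (h3 : h.PreservesFrobeniusStructure) :
    ∃ Ψpf : PreFrobenioid.Perfection hF₁ ≌ PreFrobenioid.Perfection hF₂,
      Nonempty (PreFrobenioid.Perfection.toPf hF₁ ⋙ Ψpf.functor ≅ h.Ψ.functor ⋙ PreFrobenioid.Perfection.toPf hF₂) := by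
  haveI := h.perfectionMap_isEquivalence hF₁ hF₂ h3
  exact ⟨(PreFrobenioid.Perfection.map (hF₁ := hF₁) (hF₂ := hF₂) (h.isFrobeniusCompatible h3)).asEquivalence,
    ⟨PreFrobenioid.Perfection.toPfCompMapIso (h.isFrobeniusCompatible h3)⟩⟩

end AnySetting

/-! ### At the tree vocabularies: inputs `Remark372 D₀ / D₀'`, `hBmon₁ / hBmon₂` only -/

section TreeVocab

variable {K : Type u₀} [Field K] {K' : Type u₀} [Field K'] {D₀ : Type u₀} [Category.{v₀} D₀]
  {X₁ : SemiGraphs.TemperedArithmeticGroup.{u₀} K} {X₂ : SemiGraphs.TemperedArithmeticGroup.{u₀} K'}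
  {D₀' : Type u₀} [Category.{v₀} D₀']
  {T₁ : RealifiedDivisorMonoids (D₀ := D₀) treeMonoidVocab.{w}}
  {T₂ : RealifiedDivisorMonoids (D₀ := D₀') treeMonoidVocab.{w}}
  {D₁ D₂ : Type u} [Category.{v} D₁] [Category.{v} D₂]
  {IsRational₁ IsStrictlyRational₁ : (D₁ᵒᵖ ⥤ CommMonCat.{w}) → Prop}
  {IsRational₂ IsStrictlyRational₂ : (D₂ᵒᵖ ⥤ CommMonCat.{w}) → Prop}
  {S₁ : BiKummerSetting X₁ T₁ D₁ (treeCatVocab D₁ IsRational₁ IsStrictlyRational₁)}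
  {S₂ : BiKummerSetting X₂ T₂ D₂ (treeCatVocab D₂ IsRational₂ IsStrictlyRational₂)}

/-- **Thm 4.4 (ii), clause (a), categorical, at the tree vocabularies** ⇐ {Rmk 3.7.2, `hBmon`}: "`C_i` is a
Frobenioid" by `isFrobenioid_treeCatVocab_of_isMonoidOn` ([FrdI] Thm 5.2 (i)), T44-L03 by
`preservesFrobeniusStructure_treeVocab` ([FrdI] Thm 3.4 (iii), FSM-type bases by Rmk 3.7.2).
[cite: MochizukiEtTh2009, Thm 4.4 (ii) p.94] -/
theorem Thm44Hyp.oneUniqueSquare_birat_treeVocab (h : Thm44Hyp S₁ S₂)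
    (h372 : TemperedFrobenioid.Remark372 D₀) (h372' : TemperedFrobenioid.Remark372 D₀')
    (hBmon₁ : IsMonoidOn S₁.tf.ratFnFunctor) (hBmon₂ : IsMonoidOn S₂.tf.ratFnFunctor) :
    PreFrobenioidData.OneUniqueSquare h.Ψ.functor
      (PreFrobenioid.toBirat S₁.F (S₁.tf.isFrobenioid_treeCatVocab_of_isMonoidOn hBmon₁)
        (PreFrobenioid.hasBiratSquares_of_isFrobenioid (S₁.tf.isFrobenioid_treeCatVocab_of_isMonoidOn hBmon₁)))
      (PreFrobenioid.toBirat S₂.F (S₂.tf.isFrobenioid_treeCatVocab_of_isMonoidOn hBmon₂)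
        (PreFrobenioid.hasBiratSquares_of_isFrobenioid (S₂.tf.isFrobenioid_treeCatVocab_of_isMonoidOn hBmon₂)))
      (PreFrobenioid.Birat.mapOfEquiv (S₁.tf.isFrobenioid_treeCatVocab_of_isMonoidOn hBmon₁)
        (PreFrobenioid.hasBiratSquares_of_isFrobenioid (S₁.tf.isFrobenioid_treeCatVocab_of_isMonoidOn hBmon₁))
        (S₂.tf.isFrobenioid_treeCatVocab_of_isMonoidOn hBmon₂)
        (PreFrobenioid.hasBiratSquares_of_isFrobenioid (S₂.tf.isFrobenioid_treeCatVocab_of_isMonoidOn hBmon₂))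
        h.Ψ (fun _ _ _ hf => h.isCoAngularPreStep_map
          (h.preservesFrobeniusStructure_treeVocab h372 h372' hBmon₁ hBmon₂) hf)) :=
  h.oneUniqueSquare_birat _ _ (h.preservesFrobeniusStructure_treeVocab h372 h372' hBmon₁ hBmon₂)

/-- **Thm 4.4 (ii), clause (a), print's wording, at the tree vocabularies** ⇐ {Rmk 3.7.2, `hBmon`}.
[cite: MochizukiEtTh2009, Thm 4.4 (ii) p.94] -/
theorem Thm44Hyp.exists_biratEquivalence_treeVocab (h : Thm44Hyp S₁ S₂)
    (h372 : TemperedFrobenioid.Remark372 D₀) (h372' : TemperedFrobenioid.Remark372 D₀')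
    (hBmon₁ : IsMonoidOn S₁.tf.ratFnFunctor) (hBmon₂ : IsMonoidOn S₂.tf.ratFnFunctor) :
    ∃ Ψbirat : PreFrobenioid.Birat S₁.F (S₁.tf.isFrobenioid_treeCatVocab_of_isMonoidOn hBmon₁)
          (PreFrobenioid.hasBiratSquares_of_isFrobenioid (S₁.tf.isFrobenioid_treeCatVocab_of_isMonoidOn hBmon₁)) ≌
        PreFrobenioid.Birat S₂.F (S₂.tf.isFrobenioid_treeCatVocab_of_isMonoidOn hBmon₂)
          (PreFrobenioid.hasBiratSquares_of_isFrobenioid (S₂.tf.isFrobenioid_treeCatVocab_of_isMonoidOn hBmon₂)),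
      Nonempty (PreFrobenioid.toBirat S₁.F _
          (PreFrobenioid.hasBiratSquares_of_isFrobenioid (S₁.tf.isFrobenioid_treeCatVocab_of_isMonoidOn hBmon₁)) ⋙
          Ψbirat.functor ≅
        h.Ψ.functor ⋙ PreFrobenioid.toBirat S₂.F _
          (PreFrobenioid.hasBiratSquares_of_isFrobenioid (S₂.tf.isFrobenioid_treeCatVocab_of_isMonoidOn hBmon₂))) :=
  h.exists_biratEquivalence _ _ (h.preservesFrobeniusStructure_treeVocab h372 h372' hBmon₁ hBmon₂)

/-- **[FrdI] Cor 4.10 AS TYPED at `(C₁, C₂, Ψ)`, tree vocabularies** ⇐ {Rmk 3.7.2, `hBmon`}.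
[cite: MochizukiEtTh2009, Thm 4.4 (ii) p.95] -/
theorem Thm44Hyp.cor410_birat_treeVocab (h : Thm44Hyp S₁ S₂)
    (h372 : TemperedFrobenioid.Remark372 D₀) (h372' : TemperedFrobenioid.Remark372 D₀')
    (hBmon₁ : IsMonoidOn S₁.tf.ratFnFunctor) (hBmon₂ : IsMonoidOn S₂.tf.ratFnFunctor) :
    PreFrobenioidData.Cor410 (PreFrobenioidData.ofFunctor S₁.tf.divisorMonoid S₁.F)
      (PreFrobenioidData.ofFunctor S₂.tf.divisorMonoid S₂.F) h.Ψ
      (PreFrobenioid.biratData (S₁.tf.isFrobenioid_treeCatVocab_of_isMonoidOn hBmon₁)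
        (PreFrobenioid.hasBiratSquares_of_isFrobenioid (S₁.tf.isFrobenioid_treeCatVocab_of_isMonoidOn hBmon₁)))
      (PreFrobenioid.biratData (S₂.tf.isFrobenioid_treeCatVocab_of_isMonoidOn hBmon₂)
        (PreFrobenioid.hasBiratSquares_of_isFrobenioid (S₂.tf.isFrobenioid_treeCatVocab_of_isMonoidOn hBmon₂))) :=
  h.cor410_birat _ _ (h.preservesFrobeniusStructure_treeVocab h372 h372' hBmon₁ hBmon₂)

/-- **T44-L11 at the tree vocabularies** ⇐ {Rmk 3.7.2, `hBmon`}: `Ψ^pf` is an equivalence.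
[cite: MochizukiEtTh2009, Thm 4.4 (ii) p.95] -/
theorem Thm44Hyp.perfectionMap_isEquivalence_treeVocab (h : Thm44Hyp S₁ S₂)
    (h372 : TemperedFrobenioid.Remark372 D₀) (h372' : TemperedFrobenioid.Remark372 D₀')
    (hBmon₁ : IsMonoidOn S₁.tf.ratFnFunctor) (hBmon₂ : IsMonoidOn S₂.tf.ratFnFunctor) :
    (PreFrobenioid.Perfection.map (hF₁ := S₁.tf.isFrobenioid_treeCatVocab_of_isMonoidOn hBmon₁)
      (hF₂ := S₂.tf.isFrobenioid_treeCatVocab_of_isMonoidOn hBmon₂)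
      (h.isFrobeniusCompatible (h.preservesFrobeniusStructure_treeVocab h372 h372' hBmon₁ hBmon₂))).IsEquivalence :=
  h.perfectionMap_isEquivalence _ _ (h.preservesFrobeniusStructure_treeVocab h372 h372' hBmon₁ hBmon₂)

/-- **T44-L11 at the tree vocabularies, print's wording** ⇐ {Rmk 3.7.2, `hBmon`}: an equivalence
`Ψ^pf : C₁^pf ⥲ C₂^pf` with `(C₁ → C₁^pf) ⋙ Ψ^pf ≅ Ψ ⋙ (C₂ → C₂^pf)`. [cite: MochizukiEtTh2009, Thm 4.4 (ii) p.95] -/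
theorem Thm44Hyp.exists_pfEquivalence_treeVocab (h : Thm44Hyp S₁ S₂)
    (h372 : TemperedFrobenioid.Remark372 D₀) (h372' : TemperedFrobenioid.Remark372 D₀')
    (hBmon₁ : IsMonoidOn S₁.tf.ratFnFunctor) (hBmon₂ : IsMonoidOn S₂.tf.ratFnFunctor) :
    ∃ Ψpf : PreFrobenioid.Perfection (S₁.tf.isFrobenioid_treeCatVocab_of_isMonoidOn hBmon₁) ≌
        PreFrobenioid.Perfection (S₂.tf.isFrobenioid_treeCatVocab_of_isMonoidOn hBmon₂),
      Nonempty (PreFrobenioid.Perfection.toPf (S₁.tf.isFrobenioid_treeCatVocab_of_isMonoidOn hBmon₁) ⋙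
          Ψpf.functor ≅
        h.Ψ.functor ⋙ PreFrobenioid.Perfection.toPf (S₂.tf.isFrobenioid_treeCatVocab_of_isMonoidOn hBmon₂)) :=
  h.exists_pfEquivalence _ _ (h.preservesFrobeniusStructure_treeVocab h372 h372' hBmon₁ hBmon₂)

end TreeVocab

/-! ### At the genuine connected base `B^temp(Π^tp_X)⁰` (abc-iut-L2-t4's `mkOfConnectedTemperoid`) -/

section Connected

variable {K : Type u₀} [Field K] {K' : Type u₀} [Field K'] {X₁ : SemiGraphs.TemperedArithmeticGroup.{u₀} K}
  {X₂ : SemiGraphs.TemperedArithmeticGroup.{u₀} K'} {D₀ : Type u₀} [Category.{v₀} D₀] {D₀' : Type u₀}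
  [Category.{v₀} D₀'] {T₁ : RealifiedDivisorMonoids (D₀ := D₀) treeMonoidVocab.{w}}
  {T₂ : RealifiedDivisorMonoids (D₀ := D₀') treeMonoidVocab.{w}}
  {IsRational₁ IsStrictlyRational₁ : ((ConnectedPart (BTemp X₁.Pi))ᵒᵖ ⥤ CommMonCat.{w}) → Prop}
  {IsRational₂ IsStrictlyRational₂ : ((ConnectedPart (BTemp X₂.Pi))ᵒᵖ ⥤ CommMonCat.{w}) → Prop}
  {tf₁ : TemperedFrobenioid T₁ (ConnectedPart (BTemp X₁.Pi))
    (treeCatVocab (ConnectedPart (BTemp X₁.Pi)) IsRational₁ IsStrictlyRational₁)}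
  {hZ₁ : tf₁.monoidType = MonoidType.Z} {hP₁ : ∀ A : (ConnectedPart (BTemp X₁.Pi))ᵒᵖ, IsPerfect (tf₁.Φ.carrier A)}
  {NH₁ : Subgroup (Field.absoluteGaloisGroup K) → tf₁.category → ℕ+ → Prop} {A₁ : tf₁.category}
  {hA₁ : PreFrobenioid.IsFrobeniusTrivial tf₁.toElem A₁} {hA₁' : SemiGraphs.IsGaloisObj A₁.base.obj}
  {tf₂ : TemperedFrobenioid T₂ (ConnectedPart (BTemp X₂.Pi))
    (treeCatVocab (ConnectedPart (BTemp X₂.Pi)) IsRational₂ IsStrictlyRational₂)}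
  {hZ₂ : tf₂.monoidType = MonoidType.Z} {hP₂ : ∀ B : (ConnectedPart (BTemp X₂.Pi))ᵒᵖ, IsPerfect (tf₂.Φ.carrier B)}
  {NH₂ : Subgroup (Field.absoluteGaloisGroup K') → tf₂.category → ℕ+ → Prop} {A₂ : tf₂.category}
  {hA₂ : PreFrobenioid.IsFrobeniusTrivial tf₂.toElem A₂} {hA₂' : SemiGraphs.IsGaloisObj A₂.base.obj}

/-- **Thm 4.4 (ii), clause (a), print's wording, at the genuine connected base** ⇐ {Rmk 3.7.2, `hBmon`}: an
equivalence `Ψ^birat : C₁^birat ⥲ C₂^birat` with `(C₁ → C₁^birat) ⋙ Ψ^birat ≅ Ψ ⋙ (C₂ → C₂^birat)`.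
[cite: MochizukiEtTh2009, Thm 4.4 (ii) p.94] -/
theorem Thm44Hyp.exists_biratEquivalence_mkOfConnectedTemperoid
    (h : Thm44Hyp (mkOfConnectedTemperoid X₁ tf₁ hZ₁ hP₁ NH₁ A₁ hA₁ hA₁')
      (mkOfConnectedTemperoid X₂ tf₂ hZ₂ hP₂ NH₂ A₂ hA₂ hA₂'))
    (h372 : TemperedFrobenioid.Remark372 D₀) (h372' : TemperedFrobenioid.Remark372 D₀')
    (hBmon₁ : IsMonoidOn tf₁.ratFnFunctor) (hBmon₂ : IsMonoidOn tf₂.ratFnFunctor) :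
    ∃ Ψbirat : PreFrobenioid.Birat tf₁.toElem (tf₁.isFrobenioid_treeCatVocab_of_isMonoidOn hBmon₁)
          (PreFrobenioid.hasBiratSquares_of_isFrobenioid (tf₁.isFrobenioid_treeCatVocab_of_isMonoidOn hBmon₁)) ≌
        PreFrobenioid.Birat tf₂.toElem (tf₂.isFrobenioid_treeCatVocab_of_isMonoidOn hBmon₂)
          (PreFrobenioid.hasBiratSquares_of_isFrobenioid (tf₂.isFrobenioid_treeCatVocab_of_isMonoidOn hBmon₂)),
      Nonempty (PreFrobenioid.toBirat tf₁.toElem _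
          (PreFrobenioid.hasBiratSquares_of_isFrobenioid (tf₁.isFrobenioid_treeCatVocab_of_isMonoidOn hBmon₁)) ⋙
          Ψbirat.functor ≅
        h.Ψ.functor ⋙ PreFrobenioid.toBirat tf₂.toElem _
          (PreFrobenioid.hasBiratSquares_of_isFrobenioid (tf₂.isFrobenioid_treeCatVocab_of_isMonoidOn hBmon₂))) :=
  h.exists_biratEquivalence_treeVocab h372 h372' hBmon₁ hBmon₂

/-- **[FrdI] Cor 4.10 AS TYPED at `(C₁, C₂, Ψ)`, genuine connected base** ⇐ {Rmk 3.7.2, `hBmon`}.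
[cite: MochizukiEtTh2009, Thm 4.4 (ii) p.95] -/
theorem Thm44Hyp.cor410_birat_mkOfConnectedTemperoid
    (h : Thm44Hyp (mkOfConnectedTemperoid X₁ tf₁ hZ₁ hP₁ NH₁ A₁ hA₁ hA₁')
      (mkOfConnectedTemperoid X₂ tf₂ hZ₂ hP₂ NH₂ A₂ hA₂ hA₂'))
    (h372 : TemperedFrobenioid.Remark372 D₀) (h372' : TemperedFrobenioid.Remark372 D₀')
    (hBmon₁ : IsMonoidOn tf₁.ratFnFunctor) (hBmon₂ : IsMonoidOn tf₂.ratFnFunctor) :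
    PreFrobenioidData.Cor410 (PreFrobenioidData.ofFunctor tf₁.divisorMonoid tf₁.toElem)
      (PreFrobenioidData.ofFunctor tf₂.divisorMonoid tf₂.toElem) h.Ψ
      (PreFrobenioid.biratData (tf₁.isFrobenioid_treeCatVocab_of_isMonoidOn hBmon₁)
        (PreFrobenioid.hasBiratSquares_of_isFrobenioid (tf₁.isFrobenioid_treeCatVocab_of_isMonoidOn hBmon₁)))
      (PreFrobenioid.biratData (tf₂.isFrobenioid_treeCatVocab_of_isMonoidOn hBmon₂)
        (PreFrobenioid.hasBiratSquares_of_isFrobenioid (tf₂.isFrobenioid_treeCatVocab_of_isMonoidOn hBmon₂))) :=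
  h.cor410_birat_treeVocab h372 h372' hBmon₁ hBmon₂

/-- **T44-L11, print's wording, at the genuine connected base** ⇐ {Rmk 3.7.2, `hBmon`}: an equivalence
`Ψ^pf : C₁^pf ⥲ C₂^pf` with `(C₁ → C₁^pf) ⋙ Ψ^pf ≅ Ψ ⋙ (C₂ → C₂^pf)`. [cite: MochizukiEtTh2009, Thm 4.4 (ii) p.95] -/
theorem Thm44Hyp.exists_pfEquivalence_mkOfConnectedTemperoid
    (h : Thm44Hyp (mkOfConnectedTemperoid X₁ tf₁ hZ₁ hP₁ NH₁ A₁ hA₁ hA₁')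
      (mkOfConnectedTemperoid X₂ tf₂ hZ₂ hP₂ NH₂ A₂ hA₂ hA₂'))
    (h372 : TemperedFrobenioid.Remark372 D₀) (h372' : TemperedFrobenioid.Remark372 D₀')
    (hBmon₁ : IsMonoidOn tf₁.ratFnFunctor) (hBmon₂ : IsMonoidOn tf₂.ratFnFunctor) :
    ∃ Ψpf : PreFrobenioid.Perfection (F := tf₁.toElem) (tf₁.isFrobenioid_treeCatVocab_of_isMonoidOn hBmon₁) ≌
        PreFrobenioid.Perfection (F := tf₂.toElem) (tf₂.isFrobenioid_treeCatVocab_of_isMonoidOn hBmon₂),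
      Nonempty (PreFrobenioid.Perfection.toPf (tf₁.isFrobenioid_treeCatVocab_of_isMonoidOn hBmon₁) ⋙
          Ψpf.functor ≅
        h.Ψ.functor ⋙ PreFrobenioid.Perfection.toPf (tf₂.isFrobenioid_treeCatVocab_of_isMonoidOn hBmon₂)) :=
  h.exists_pfEquivalence_treeVocab h372 h372' hBmon₁ hBmon₂

end Connected

end BiKummerSetting

end Literature.AnabelianGeometry.EtaleTheta
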